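import Summits.RiemannHypothesis.RiemannHypothesis.Theorems.WeilTwoPrimeDeflM78YBase
import Summits.RiemannHypothesis.RiemannHypothesis.Theorems.WeilTwoPrimeDeflM78YDataPO25
import Literature.NumberTheory.LFunctions.WeilBlockRowsPZ
import Literature.NumberTheory.LFunctions.WeilBlockRowsFast
import Literature.NumberTheory.LFunctions.WeilTwoPrimeOddMarginHDataDn12
import HarnessLib

/-!
# Deflated two-prime certificate M78Y: dominance of rows 18–19 of `R = S''_odd(κ') − UᵀU` (factored data)

`WeilCert.checkDomRowPZ` with the materialized augmented block, the factored inverse `weilCert23HDn/weilCert23HLs` and the Bessel block, by `decide +kernel` row by row. Pure proof file.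
-/

noncomputable section

namespace Summit.RiemannHypothesis.RiemannHypothesis.Theorems.EvenWinsBeyondArch

open Literature.NumberTheory.LFunctions

set_option maxHeartbeats 0 in
/-- Kernel check of the dominance of row 18 of `R` (odd block, certificate M78Y). [folklore] -/
theorem checkDomRowF1_18_weilCertDeflM78Y :
    weilCertDeflM78YBase.checkDomRowF weilCertDeflM78YPmO weilCert23HDn weilCert23HLs weilCertDeflM78YHpO weilCertDeflM78YKappa' 1 18 = true := by
  decide +kernel

/-- Kernel check of the dominance of row 18 of `R` (factored data), from the fast row. [folklore] -/
theorem checkDomRowPZ1_18_weilCertDeflM78Y :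
    weilCertDeflM78YBase.checkDomRowPZ weilCertDeflM78YPmO weilCert23HDn weilCert23HLs weilCertDeflM78YHpO weilCertDeflM78YKappa' 1 18 = true :=
  WeilCert.checkDomRowPZ_of_F (by decide) checkDomRowF1_18_weilCertDeflM78Y

set_option maxHeartbeats 0 in
/-- Kernel check of the dominance of row 19 of `R` (odd block, certificate M78Y). [folklore] -/
theorem checkDomRowF1_19_weilCertDeflM78Y :
    weilCertDeflM78YBase.checkDomRowF weilCertDeflM78YPmO weilCert23HDn weilCert23HLs weilCertDeflM78YHpO weilCertDeflM78YKappa' 1 19 = true := by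
  decide +kernel

/-- Kernel check of the dominance of row 19 of `R` (factored data), from the fast row. [folklore] -/
theorem checkDomRowPZ1_19_weilCertDeflM78Y :
    weilCertDeflM78YBase.checkDomRowPZ weilCertDeflM78YPmO weilCert23HDn weilCert23HLs weilCertDeflM78YHpO weilCertDeflM78YKappa' 1 19 = true :=
  WeilCert.checkDomRowPZ_of_F (by decide) checkDomRowF1_19_weilCertDeflM78Y


end Summit.RiemannHypothesis.RiemannHypothesis.Theorems.EvenWinsBeyondArch
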